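import Summits.BirchSwinnertonDyer.BirchSwinnertonDyer.Theorems.QuadraticBranchSignedControlNoFiniteSubmoduleGlue
import Summits.BirchSwinnertonDyer.Rank1Residual.Additive.StrictSignedSelmerDual
import Summits.BirchSwinnertonDyer.Rank1Residual.Iwasawa.NoFiniteSubmoduleOfSelfDualLayers
import HarnessLib

/-!
# The K8 node (R2±) `NoFiniteSubmoduleSigned` by the HACHIMORI–MATSUNO ROAD: the strict signed dual
# `X^{ε,str}(W/ℚ_∞)` has no non-zero finite `Λ`-submodule as soon as the layers `Sel^{ε,str}(W/ℚ_n)`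
# carry Cassels–Tate-type (self-dual, Galois-equivariant, res/cores-adjoint) pairings modulo
# stabilised divisible parts — the pure-algebra criterion
# `Rank1Residual.Iwasawa.forall_finite_eq_bot_of_selfDualLayers` applied to the tree's objects
# (cell `bsd-potss`, seat `bsd-potss-k8q-c5` g3; route `QuadraticBranchSignedControl`,
# items stmt-BirchSwinnertonDyer-19117 / 19222 / 19233, binder 19301 `PublishedInputKO13`)

HONEST FRAMING (cell `bsd-potss`, run/shared/lean/pub/bsd-potss/; FULL-BSD rank ≤ 1 programme,
tranche 1b): THEOREMS ONLY, all CONDITIONAL — nothing here closes an item. The three (R2±) items are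
settled by citation through the binder `PublishedInputKO13` (Kitajima–Otsuki 2018 Main Thm. 1.3,
`F = ℚ`). Seat g2 reduced that binder BY NAME to Kitajima–Otsuki's own inputs ((I) Thm. 4.5 ∧ (L)
[Gre99] Thm. 1.7 ∧ Prop. 3.32, with §4.2 in the kernel). THIS FILE opens the SECOND road of print —
the one behind Thm. 4.5 itself (§4.1: Matsuno 2003 Prop. 4.1 = Hachimori–Matsuno, Proc. AMS 128
(2000), via the Cassels–Tate pairing) — DIRECTLY for the items' objects: by the kernel theorem
`Rank1Residual.Iwasawa.forall_finite_eq_bot_of_selfDualLayers` (this seat, `NoFiniteSubmoduleOfSelfDualLayers`),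
for EVERY strict signed dual datum `D : StrictSignedSelmerDualData W κ E γ ε` (any number field, any
`ℤ_p`-extension, any sign, any model `E`) the module `D.X` has no non-zero finite `Λ`-submodule once
`Sel^{ε,str}(W/K_∞)` (with its `conj_γ`-action) admits a HACHIMORI–MATSUNO LAYER PACKAGE: injective,
exhausting, `Γ`-stable layers `L_n → Sel^{ε,str}_∞` with transitions, corestrictions realising the norm
of `Gal(K_{n+1}/K_n)` in `Sel^{ε,str}_∞`, `p`-divisible `Γ`-stable subgroups `D_n ≤ L_n` whose images
stop growing, and biadditive `Γ`-invariant pairings on `L_n` with right kernel exactly `D_n`,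
representing every character of `L_n/D_n`, under which transition and corestriction are adjoint
(§1, `StrictSignedSelmerDualData.forall_finite_eq_bot_of_layerPackage`). For `K = ℚ`, `κ`
cyclotomic, `E = ℚ_p`, `W` the `p*`-twist of a good `a_p = 0` curve and `L_n = Sel^{ε,str}(W/ℚ_n)`
(`strictSignedSelmerLayer`, `r_n = layerToInfty`), the package is, in print: Kobayashi's Lemma 9.1
(injective layers: `W(ℚ_∞)[p] = 0`), cofinite generation of `Sel^{ε,str}(W/ℚ_n)` with `D_n` its
maximal divisible subgroup (stabilisation from the `Λ`-torsion of `X^{ε,str}`, Kobayashi Thm. 2.2 /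
hypothesis (vi)), and the generalised Cassels–Tate pairing on `Sel^±/div` (B. D. Kim, Compositio 143
(2007) §3–§4: self-duality of the `±` local condition under local Tate duality, Flach's pairing) read
through the `η`-dictionary — NONE of which is asserted here: the package is DISPLAYED as a hypothesis,
sign by sign (§2). What the file records in the kernel is that these — and nothing about Matsuno's
control theory, [Gre99] Thm. 1.7 or Prop. 3.32 — suffice for the node. BSD is not proved by any of
this; no label / mark / count moves.

References: [HachimoriMatsuno2000] Y. Hachimori, K. Matsuno, Proc. Amer. Math. Soc. 128 (2000)
2539–2541, Theorem, Corollary (i); [KitajimaOtsuki2018] Main Thm. 1.3, Prop. 4.1, Lemma 4.2, Thm. 4.5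
(arXiv:1607.03612 pp. 3, 18); [Kobayashi2003] Def. 2.1, Thm. 2.2 (p. 5), Lemma 9.1 (p. 25);
B. D. Kim, Compositio Math. 143 (2007) 47–72, §3 (Prop. 3.15/3.18: the `±` condition is its own exact
annihilator), §4 (Def. 4.1: the pairing) [Kim2007parity]; [GreenbergLNM1716] §1.
-/

set_option autoImplicit false
-- `Summit.BirchSwinnertonDyer.BirchSwinnertonDyer.…` is the lane's mandated namespace (sub = summit).
set_option linter.dupNamespace false

noncomputable section

open scoped Classical

universe u

open WeierstrassCurve Field Literature.NumberTheory.EllipticCurves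
  Literature.NumberTheory.GaloisRepresentations ZpExtension
  Summit.BirchSwinnertonDyer.Rank1Residual Summit.BirchSwinnertonDyer.Rank1Residual.Additive

namespace Summit.BirchSwinnertonDyer.BirchSwinnertonDyer.Theorems

open Summit.BirchSwinnertonDyer.BirchSwinnertonDyer.Theses.QuadraticBranchSignedControl

/-! ## §1 Any strict signed dual datum: no finite `Λ`-submodule from a Hachimori–Matsuno layer package -/

/-- **`X^{ε,str}(W/K_∞)` has no non-zero finite `Λ`-submodule, given a Hachimori–Matsuno layer
package on `Sel^{ε,str}(W/K_∞)`** — for ANY number field `K`, `ℤ_p`-extension `κ`, model `E`, sign `ε`,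
`γ ∈ Γ_K` and ANY Pontryagin-dual datum `D : StrictSignedSelmerDualData W κ E γ ε`. The package
(displayed, existential over the layer data): layers `r_n : L_n → Sel^{ε,str}_∞` injective with
transitions `ι_n` over `Sel^{ε,str}_∞`, exhausting it, carrying a surjective action `γL_n` over
`conj_γ`; for every `t ∈ L_{n+1}` a `t' ∈ L_n` with `r_n t' = Σ_{i<p} conj_γ^{pⁿ i} r_{n+1} t`
(res ∘ cores = norm) adjoint to `ι_n` under the pairings; `p`-divisible `γL_n`-stable `D_n ≤ L_n` with
`r_{n+1}(D_{n+1}) ⊆ r_n(D_n)` for `n ≥ m`; biadditive `γL_n`-invariant pairings on `L_n` with right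
kernel exactly `D_n`, representing every character of `L_n/D_n`. Then `D.toDual` (injective, `T ↦
conj_γ − 1`) feeds `Rank1Residual.Iwasawa.forall_finite_eq_bot_of_selfDualLayers`. CONDITIONAL on the
displayed package; nothing about any Selmer group is asserted.
[cite: HachimoriMatsuno2000, Theorem and Corollary (i) (p. 2540)]
[cite: KitajimaOtsuki2018, Prop. 4.1, Lemma 4.2, Thm. 4.5 (arXiv:1607.03612 p. 18)]
[cite: Kobayashi2003, Def. 2.1 (p. 5), Lemma 9.1 (p. 25)] -/
theorem StrictSignedSelmerDualData.forall_finite_eq_bot_of_layerPackage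
    {K : Type u} [Field K] [NumberField K] {W : WeierstrassCurve K} {p : ℕ} [Fact p.Prime]
    {κ : ZpExtension K p} {E : Type u} [Field E] [Algebra K E] {γ : Field.absoluteGaloisGroup K}
    {ε : ℤˣ} (D : StrictSignedSelmerDualData W κ E γ ε)
    (hpack : ∃ (L : ℕ → Type u) (_ : ∀ n, AddCommGroup (L n))
        (r : ∀ n, L n →+ strictSignedSelmerInfty W κ E ε) (ι : ∀ n, L n →+ L (n + 1))
        (γL : ∀ n, L n →+ L n) (Dn : ∀ n, AddSubgroup (L n))
        (pair : ∀ n, L n →+ L n →+ AddCircle (1 : ℚ)) (m : ℕ),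
      (∀ n, Function.Injective (r n)) ∧
      (∀ n (x : L n), r (n + 1) (ι n x) = r n x) ∧
      (∀ s : strictSignedSelmerInfty W κ E ε, ∃ n, ∃ x : L n, r n x = s) ∧
      (∀ n (x : L n), r n (γL n x) = conjStrictSignedSelmerInfty W κ E ε γ (r n x)) ∧
      (∀ n, Function.Surjective (γL n)) ∧
      (∀ n (t : L (n + 1)), ∃ t' : L n,
        r n t' = ∑ i ∈ Finset.range p,
          ((conjStrictSignedSelmerInfty W κ E ε γ) ^ (p ^ n * i)) (r (n + 1) t) ∧
        ∀ y : L n, pair n y t' = pair (n + 1) (ι n y) t) ∧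
      (∀ n, ∀ d ∈ Dn n, ∃ d' ∈ Dn n, p • d' = d) ∧
      (∀ n, ∀ d ∈ Dn n, γL n d ∈ Dn n) ∧
      (∀ n, m ≤ n → (Dn (n + 1)).map (r (n + 1)) ≤ (Dn n).map (r n)) ∧
      (∀ n (t : L n), (∀ y : L n, pair n y t = 0) → t ∈ Dn n) ∧
      (∀ n, ∀ t ∈ Dn n, ∀ y : L n, pair n y t = 0) ∧
      (∀ n (g : L n →+ AddCircle (1 : ℚ)), (∀ d ∈ Dn n, g d = 0) →
        ∃ c : L n, ∀ y : L n, g y = pair n y c) ∧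
      (∀ n (y t : L n), pair n (γL n y) (γL n t) = pair n y t)) :
    ∀ M : Submodule (IwasawaAlgebra p) D.X, Finite M → M = ⊥ := by
  obtain ⟨L, instL, r, ι, γL, Dn, pair, m, hr, hι, hex, hγL, hγLs, hcores, hDdiv, hDγ, hDst, hker,
    hD0, hsurj, hinv⟩ := hpack
  exact Iwasawa.forall_finite_eq_bot_of_selfDualLayers p (conjStrictSignedSelmerInfty W κ E ε γ) r ι
    γL Dn pair D.toDual hr hι hex hγL hγLs hcores hDdiv hDγ m hDst hker hD0 hsurj hinv D.bijective.1
    fun x s ↦ D.toDual_T_smul x s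

/-! ## §2 The K8 nodes (R2⁺), (R2⁻), (R2±) from the sign-by-sign layer packages on the quadratic branch -/

/-- **(R2⁺) `NoFiniteSubmodulePlus` (item stmt-BirchSwinnertonDyer-19222) by the Hachimori–Matsuno
road**: if, for every Gss2 datum of the item (`W/ℚ` globally minimal, `p ≥ 5`, `V` a globally minimal
model of `W^{(p*)}` with good reduction and `a_p(V) = 0`, `κ` cyclotomic with topological generator
`γ`, a Pontryagin-dual datum `D` of `Sel^{+,str}(W/ℚ_∞)` with `X` finitely generated `Λ`-torsion),
`Sel^{+,str}(W/ℚ_∞)` admits a Hachimori–Matsuno layer package (displayed; in print = Kobayashi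
Lemma 9.1 + cofinite generation/stabilisation + B. D. Kim's generalised Cassels–Tate pairing on
`Sel⁺(V/ℚ(μ_{p^{n+1}}))/div` read at `η`), then the item holds. CONDITIONAL; closes nothing by itself.
[cite: HachimoriMatsuno2000, Theorem and Corollary (i) (p. 2540)]
[cite: KitajimaOtsuki2018, Main Thm. 1.3, Prop. 4.1, Thm. 4.5 (arXiv:1607.03612 pp. 3, 18)]
[cite: Kobayashi2003, Def. 2.1, Thm. 2.2 (p. 5), Lemma 9.1 (p. 25)] -/
theorem noFiniteSubmodulePlus_of_layerPackage
    (h : ∀ (W : WeierstrassCurve ℚ) [W.IsElliptic] [W.IsGloballyMinimal] (p : ℕ) [Fact p.Prime]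
        (V : WeierstrassCurve ℚ) [V.IsElliptic] [V.IsGloballyMinimal] (C : VariableChange ℚ),
      5 ≤ p → C • W.quadraticTwist ((-1) ^ (p / 2) * p) = V →
      V.HasGoodReductionAtPrime p → V.frobeniusTrace p = 0 →
      ∀ (κ : ZpExtension ℚ p) (γ : Field.absoluteGaloisGroup ℚ),
        κ.IsCyclotomic → κ.IsTopGenerator γ →
      ∀ (D : StrictSignedSelmerDualData W κ ℚ_[p] γ 1),
        Module.Finite (IwasawaAlgebra p) D.X → Module.IsTorsion (IwasawaAlgebra p) D.X →
      ∃ (L : ℕ → Type) (_ : ∀ n, AddCommGroup (L n))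
        (r : ∀ n, L n →+ strictSignedSelmerInfty W κ ℚ_[p] 1) (ι : ∀ n, L n →+ L (n + 1))
        (γL : ∀ n, L n →+ L n) (Dn : ∀ n, AddSubgroup (L n))
        (pair : ∀ n, L n →+ L n →+ AddCircle (1 : ℚ)) (m : ℕ),
      (∀ n, Function.Injective (r n)) ∧
      (∀ n (x : L n), r (n + 1) (ι n x) = r n x) ∧
      (∀ s : strictSignedSelmerInfty W κ ℚ_[p] 1, ∃ n, ∃ x : L n, r n x = s) ∧
      (∀ n (x : L n), r n (γL n x) = conjStrictSignedSelmerInfty W κ ℚ_[p] 1 γ (r n x)) ∧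
      (∀ n, Function.Surjective (γL n)) ∧
      (∀ n (t : L (n + 1)), ∃ t' : L n,
        r n t' = ∑ i ∈ Finset.range p,
          ((conjStrictSignedSelmerInfty W κ ℚ_[p] 1 γ) ^ (p ^ n * i)) (r (n + 1) t) ∧
        ∀ y : L n, pair n y t' = pair (n + 1) (ι n y) t) ∧
      (∀ n, ∀ d ∈ Dn n, ∃ d' ∈ Dn n, p • d' = d) ∧
      (∀ n, ∀ d ∈ Dn n, γL n d ∈ Dn n) ∧
      (∀ n, m ≤ n → (Dn (n + 1)).map (r (n + 1)) ≤ (Dn n).map (r n)) ∧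
      (∀ n (t : L n), (∀ y : L n, pair n y t = 0) → t ∈ Dn n) ∧
      (∀ n, ∀ t ∈ Dn n, ∀ y : L n, pair n y t = 0) ∧
      (∀ n (g : L n →+ AddCircle (1 : ℚ)), (∀ d ∈ Dn n, g d = 0) →
        ∃ c : L n, ∀ y : L n, g y = pair n y c) ∧
      (∀ n (y t : L n), pair n (γL n y) (γL n t) = pair n y t)) :
    NoFiniteSubmodulePlus := by
  intro W _ _ p _ hp5 V _ _ C _ hC hgood hap κ γ hκ hγ D hfin htor M hM
  exact StrictSignedSelmerDualData.forall_finite_eq_bot_of_layerPackage D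
    (h W p V C hp5 hC hgood hap κ γ hκ hγ D hfin htor) M hM

/-- **(R2⁻) `NoFiniteSubmoduleMinus` (item stmt-BirchSwinnertonDyer-19233) by the Hachimori–Matsuno
road**: the same with the STRICT minus condition (`ε = −1`, Kobayashi's `m = −1` clause; in print the
pairing is B. D. Kim's on `Sel⁻(V/ℚ(μ_{p^{n+1}}))/div` read at `η`). CONDITIONAL; closes nothing by itself.
[cite: HachimoriMatsuno2000, Theorem and Corollary (i) (p. 2540)]
[cite: KitajimaOtsuki2018, Main Thm. 1.3, Prop. 4.1, Thm. 4.5 (arXiv:1607.03612 pp. 3, 18)]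
[cite: Kobayashi2003, Def. 2.1, Thm. 2.2 (p. 5), §2 p. 4 (the m = −1 clause), Lemma 9.1 (p. 25)] -/
theorem noFiniteSubmoduleMinus_of_layerPackage
    (h : ∀ (W : WeierstrassCurve ℚ) [W.IsElliptic] [W.IsGloballyMinimal] (p : ℕ) [Fact p.Prime]
        (V : WeierstrassCurve ℚ) [V.IsElliptic] [V.IsGloballyMinimal] (C : VariableChange ℚ),
      5 ≤ p → C • W.quadraticTwist ((-1) ^ (p / 2) * p) = V →
      V.HasGoodReductionAtPrime p → V.frobeniusTrace p = 0 →
      ∀ (κ : ZpExtension ℚ p) (γ : Field.absoluteGaloisGroup ℚ),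
        κ.IsCyclotomic → κ.IsTopGenerator γ →
      ∀ (D : StrictSignedSelmerDualData W κ ℚ_[p] γ (-1)),
        Module.Finite (IwasawaAlgebra p) D.X → Module.IsTorsion (IwasawaAlgebra p) D.X →
      ∃ (L : ℕ → Type) (_ : ∀ n, AddCommGroup (L n))
        (r : ∀ n, L n →+ strictSignedSelmerInfty W κ ℚ_[p] (-1)) (ι : ∀ n, L n →+ L (n + 1))
        (γL : ∀ n, L n →+ L n) (Dn : ∀ n, AddSubgroup (L n))
        (pair : ∀ n, L n →+ L n →+ AddCircle (1 : ℚ)) (m : ℕ),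
      (∀ n, Function.Injective (r n)) ∧
      (∀ n (x : L n), r (n + 1) (ι n x) = r n x) ∧
      (∀ s : strictSignedSelmerInfty W κ ℚ_[p] (-1), ∃ n, ∃ x : L n, r n x = s) ∧
      (∀ n (x : L n), r n (γL n x) = conjStrictSignedSelmerInfty W κ ℚ_[p] (-1) γ (r n x)) ∧
      (∀ n, Function.Surjective (γL n)) ∧
      (∀ n (t : L (n + 1)), ∃ t' : L n,
        r n t' = ∑ i ∈ Finset.range p,
          ((conjStrictSignedSelmerInfty W κ ℚ_[p] (-1) γ) ^ (p ^ n * i)) (r (n + 1) t) ∧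
        ∀ y : L n, pair n y t' = pair (n + 1) (ι n y) t) ∧
      (∀ n, ∀ d ∈ Dn n, ∃ d' ∈ Dn n, p • d' = d) ∧
      (∀ n, ∀ d ∈ Dn n, γL n d ∈ Dn n) ∧
      (∀ n, m ≤ n → (Dn (n + 1)).map (r (n + 1)) ≤ (Dn n).map (r n)) ∧
      (∀ n (t : L n), (∀ y : L n, pair n y t = 0) → t ∈ Dn n) ∧
      (∀ n, ∀ t ∈ Dn n, ∀ y : L n, pair n y t = 0) ∧
      (∀ n (g : L n →+ AddCircle (1 : ℚ)), (∀ d ∈ Dn n, g d = 0) →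
        ∃ c : L n, ∀ y : L n, g y = pair n y c) ∧
      (∀ n (y t : L n), pair n (γL n y) (γL n t) = pair n y t)) :
    NoFiniteSubmoduleMinus := by
  intro W _ _ p _ hp5 V _ _ C _ hC hgood hap κ γ hκ hγ D hfin htor M hM
  exact StrictSignedSelmerDualData.forall_finite_eq_bot_of_layerPackage D
    (h W p V C hp5 hC hgood hap κ γ hκ hγ D hfin htor) M hM

/-- **(R2±) the K8 node `NoFiniteSubmoduleSigned` (item stmt-BirchSwinnertonDyer-19117) by the
Hachimori–Matsuno road**: both sign packages (displayed) give the parent node, via the sign items and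
g0's `noFiniteSubmoduleSigned_of_signs`. CONDITIONAL on the two displayed layer packages; closes
nothing by itself. After this file the node has TWO kernel roads to print: Kitajima–Otsuki's own
((I) Thm. 4.5 ∧ (L) [Gre99] 1.7 ∧ Prop. 3.32, seat g2) and Hachimori–Matsuno's (a Cassels–Tate-type
pairing on the finite layers, this file) — the second needing NO corank count and NO local structure
theorem. [cite: HachimoriMatsuno2000, Theorem and Corollary (i) (p. 2540)]
[cite: KitajimaOtsuki2018, Main Thm. 1.3, Prop. 4.1, Thm. 4.5 (arXiv:1607.03612 pp. 3, 18)]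
[cite: Kobayashi2003, Def. 2.1, Thm. 2.2 (p. 5), Lemma 9.1 (p. 25)] -/
theorem noFiniteSubmoduleSigned_of_layerPackages
    (hplus : ∀ (W : WeierstrassCurve ℚ) [W.IsElliptic] [W.IsGloballyMinimal] (p : ℕ) [Fact p.Prime]
        (V : WeierstrassCurve ℚ) [V.IsElliptic] [V.IsGloballyMinimal] (C : VariableChange ℚ),
      5 ≤ p → C • W.quadraticTwist ((-1) ^ (p / 2) * p) = V →
      V.HasGoodReductionAtPrime p → V.frobeniusTrace p = 0 →
      ∀ (κ : ZpExtension ℚ p) (γ : Field.absoluteGaloisGroup ℚ),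
        κ.IsCyclotomic → κ.IsTopGenerator γ →
      ∀ (D : StrictSignedSelmerDualData W κ ℚ_[p] γ 1),
        Module.Finite (IwasawaAlgebra p) D.X → Module.IsTorsion (IwasawaAlgebra p) D.X →
      ∃ (L : ℕ → Type) (_ : ∀ n, AddCommGroup (L n))
        (r : ∀ n, L n →+ strictSignedSelmerInfty W κ ℚ_[p] 1) (ι : ∀ n, L n →+ L (n + 1))
        (γL : ∀ n, L n →+ L n) (Dn : ∀ n, AddSubgroup (L n))
        (pair : ∀ n, L n →+ L n →+ AddCircle (1 : ℚ)) (m : ℕ),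
      (∀ n, Function.Injective (r n)) ∧
      (∀ n (x : L n), r (n + 1) (ι n x) = r n x) ∧
      (∀ s : strictSignedSelmerInfty W κ ℚ_[p] 1, ∃ n, ∃ x : L n, r n x = s) ∧
      (∀ n (x : L n), r n (γL n x) = conjStrictSignedSelmerInfty W κ ℚ_[p] 1 γ (r n x)) ∧
      (∀ n, Function.Surjective (γL n)) ∧
      (∀ n (t : L (n + 1)), ∃ t' : L n,
        r n t' = ∑ i ∈ Finset.range p,
          ((conjStrictSignedSelmerInfty W κ ℚ_[p] 1 γ) ^ (p ^ n * i)) (r (n + 1) t) ∧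
        ∀ y : L n, pair n y t' = pair (n + 1) (ι n y) t) ∧
      (∀ n, ∀ d ∈ Dn n, ∃ d' ∈ Dn n, p • d' = d) ∧
      (∀ n, ∀ d ∈ Dn n, γL n d ∈ Dn n) ∧
      (∀ n, m ≤ n → (Dn (n + 1)).map (r (n + 1)) ≤ (Dn n).map (r n)) ∧
      (∀ n (t : L n), (∀ y : L n, pair n y t = 0) → t ∈ Dn n) ∧
      (∀ n, ∀ t ∈ Dn n, ∀ y : L n, pair n y t = 0) ∧
      (∀ n (g : L n →+ AddCircle (1 : ℚ)), (∀ d ∈ Dn n, g d = 0) →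
        ∃ c : L n, ∀ y : L n, g y = pair n y c) ∧
      (∀ n (y t : L n), pair n (γL n y) (γL n t) = pair n y t))
    (hminus : ∀ (W : WeierstrassCurve ℚ) [W.IsElliptic] [W.IsGloballyMinimal] (p : ℕ) [Fact p.Prime]
        (V : WeierstrassCurve ℚ) [V.IsElliptic] [V.IsGloballyMinimal] (C : VariableChange ℚ),
      5 ≤ p → C • W.quadraticTwist ((-1) ^ (p / 2) * p) = V →
      V.HasGoodReductionAtPrime p → V.frobeniusTrace p = 0 →
      ∀ (κ : ZpExtension ℚ p) (γ : Field.absoluteGaloisGroup ℚ),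
        κ.IsCyclotomic → κ.IsTopGenerator γ →
      ∀ (D : StrictSignedSelmerDualData W κ ℚ_[p] γ (-1)),
        Module.Finite (IwasawaAlgebra p) D.X → Module.IsTorsion (IwasawaAlgebra p) D.X →
      ∃ (L : ℕ → Type) (_ : ∀ n, AddCommGroup (L n))
        (r : ∀ n, L n →+ strictSignedSelmerInfty W κ ℚ_[p] (-1)) (ι : ∀ n, L n →+ L (n + 1))
        (γL : ∀ n, L n →+ L n) (Dn : ∀ n, AddSubgroup (L n))
        (pair : ∀ n, L n →+ L n →+ AddCircle (1 : ℚ)) (m : ℕ),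
      (∀ n, Function.Injective (r n)) ∧
      (∀ n (x : L n), r (n + 1) (ι n x) = r n x) ∧
      (∀ s : strictSignedSelmerInfty W κ ℚ_[p] (-1), ∃ n, ∃ x : L n, r n x = s) ∧
      (∀ n (x : L n), r n (γL n x) = conjStrictSignedSelmerInfty W κ ℚ_[p] (-1) γ (r n x)) ∧
      (∀ n, Function.Surjective (γL n)) ∧
      (∀ n (t : L (n + 1)), ∃ t' : L n,
        r n t' = ∑ i ∈ Finset.range p,
          ((conjStrictSignedSelmerInfty W κ ℚ_[p] (-1) γ) ^ (p ^ n * i)) (r (n + 1) t) ∧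
        ∀ y : L n, pair n y t' = pair (n + 1) (ι n y) t) ∧
      (∀ n, ∀ d ∈ Dn n, ∃ d' ∈ Dn n, p • d' = d) ∧
      (∀ n, ∀ d ∈ Dn n, γL n d ∈ Dn n) ∧
      (∀ n, m ≤ n → (Dn (n + 1)).map (r (n + 1)) ≤ (Dn n).map (r n)) ∧
      (∀ n (t : L n), (∀ y : L n, pair n y t = 0) → t ∈ Dn n) ∧
      (∀ n, ∀ t ∈ Dn n, ∀ y : L n, pair n y t = 0) ∧
      (∀ n (g : L n →+ AddCircle (1 : ℚ)), (∀ d ∈ Dn n, g d = 0) →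
        ∃ c : L n, ∀ y : L n, g y = pair n y c) ∧
      (∀ n (y t : L n), pair n (γL n y) (γL n t) = pair n y t)) :
    NoFiniteSubmoduleSigned :=
  noFiniteSubmoduleSigned_of_signs (noFiniteSubmodulePlus_of_layerPackage hplus)
    (noFiniteSubmoduleMinus_of_layerPackage hminus)

end Summit.BirchSwinnertonDyer.BirchSwinnertonDyer.Theorems

end
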